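import Literature.NumberTheory.EllipticCurves.CasselsTateParity
import Literature.NumberTheory.EllipticCurves.ShaIsogeny
import HarnessLib

/-!
# The `Ш`-part of Cassels' formula: `corank Ш(E')[p^∞] + dim ker Ш(φ) + dim ker Ш(φ̂)` is even
# (Cassels 1965; Milne, *ADT*, I.6.9–6.13 and Rem. 6.10(a); Dokchitser–Dokchitser 2011 Thm. 30)

For homomorphisms of geometric points `f : E(K̄) → E'(K̄)`, `g : E'(K̄) → E(K̄)` over a number field
with `g ∘ f = [p]`, `f ∘ g = [p]` (an isogeny of prime degree `p` and its dual) and bi-additive pairings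
`B` on `Ш(E/K)`, `B'` on `Ш(E'/K)` which are alternating, have (left) kernel the divisible subgroup, and
are ADJOINT for `(Ш(f), Ш(g))` — `B' (Ш(f) x) y = B x (Ш(g) y)` — (in the sources: the Cassels–Tate
pairings, Milne *ADT* I Prop. 6.9, Thm. 6.13(a), Rem. 6.10(a)), this file proves

  **`#ker Ш(f) = p^m`, `#ker Ш(g) = p^n` and `corank_{ℤ_p} Ш(E'/K)[p^∞] + m + n` is even**

(`exists_natCard_ker_shaMap_even_shaCorank`), the statement about `Ш` to which the tree reduces
Cassels' parity formula for the `2`-isogeny (`cassels_selmerCorank_two_parity_iff_sha_parity`,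
`TwoIsogenySelmerGroupShaParity.lean`). The arithmetic here is only the passage to the `p`-primary parts
`Ш[p^∞]` (as in `CasselsTateParity.exists_natCard_modN_primaryComponent_sha`: `Ш` is torsion, so an
element of `Ш[p^∞]` orthogonal to `Ш[p^∞]` is orthogonal to `Ш`, hence divisible, hence in every
`p^k Ш[p^∞]`); the group theory — the passage to finite quotients and the counting — is taken as the
hypothesis `habs` (the abstract isogeny-pair parity, proved in the tree's
`Literature.NumberTheory.EllipticCurves.IsogenyPairParity` / `GroupTheory.FiniteAbelian.IsogenyPairParityFinite`
chain), so that this file has no dependency on it and states exactly what the pairing must supply.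

* `kernel_nsmul_range_of_kernel_divisible` — kernel clause on `Ш` ⇒ `p^∞`-divisibility of the
  kernel of the restricted pairing on `Ш[p^∞]`.
* `exists_natCard_ker_shaMap_even_shaCorank` — the theorem.

## References

* J. W. S. Cassels, Arithmetic on curves of genus 1. VIII, J. reine angew. Math. 217 (1965), 180–199.
* J. S. Milne, *Arithmetic Duality Theorems*, 2nd ed. (2006), I, Prop. 6.9, Rem. 6.10(a), Thm. 6.13(a).
* T. Dokchitser, V. Dokchitser, Root numbers and parity of ranks of elliptic curves, J. reine angew.
  Math. 658 (2011), Thm. 30 (= arXiv:0906.1815 Thm. 30, "Cassels' formula"). [DokchitserDokchitser2011Crelle]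

## Design

Theorems only; no named facts (the pairings and their adjointness are hypotheses). The abstract parity
is consumed as a hypothesis `habs` in exactly the shape of
`Literature.NumberTheory.EllipticCurves.exists_natCard_ker_even_zpCorank_of_adjoint`'s conclusion
(universes: `Ш ⊆ H¹` lives in the universe `u` of `K`, the values `ℚ/ℤ` in `Type`).
-/

noncomputable section

open scoped Classical
open scoped AddSubgroup
open Literature.GroupTheory.FiniteAbelian

namespace Literature.NumberTheory.EllipticCurves

open _root_.WeierstrassCurve

universe u

section PrimaryPart

variable {K : Type u} [Field K] [NumberField K] (W : WeierstrassCurve K) [W.IsElliptic]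
  (p : ℕ) [hp : Fact p.Prime]

/-- Two commuting annihilators: `a • x = 0`, `b • x = 0`, `a, b` coprime ⇒ `x = 0`. [folklore] -/
private theorem eq_zero_of_coprime_nsmul' {Q : Type*} [AddCommGroup Q] {x : Q} {a b : ℕ}
    (hab : a.Coprime b) (ha : a • x = 0) (hb : b • x = 0) : x = 0 := by
  rw [← addOrderOf_dvd_iff_nsmul_eq_zero] at ha hb
  exact AddMonoid.addOrderOf_eq_one_iff.mp (Nat.eq_one_of_dvd_coprimes hab ha hb)

omit [W.IsElliptic] hp in
/-- `Ш[p^∞]` is `p`-primary. [folklore] -/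
theorem primaryComponent_sha_isPrimary [Fact p.Prime] :
    ∀ a : AddCommGroup.primaryComponent W.sha p, ∃ n : ℕ, p ^ n • a = 0 := fun a ↦ by
  obtain ⟨n, hn⟩ := (AddCommGroup.mem_primaryComponent).mp a.2
  exact ⟨n, Subtype.ext hn⟩

/-- `Ш[p^∞][p] ⊆ Ш[p]` is finite (Silverman, *AEC*, X.4.2(b), the tree's `finite_sha_torsionBy_holds`).
[folklore] -/
theorem finite_torsionBy_primaryComponent_sha :
    Finite (↥(AddCommGroup.primaryComponent W.sha p))[(p : ℤ)] := by
  haveI : Finite (AddSubgroup.torsionBy W.sha (p : ℤ)) :=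
    W.finite_sha_torsionBy_holds p (Int.natCast_ne_zero.mpr hp.out.ne_zero)
  exact Finite.of_injective
    (fun x ↦ (⟨((x : AddCommGroup.primaryComponent W.sha p) : W.sha),
        AddSubgroup.torsionBy.nsmul_iff.mpr (by
          rw [← AddSubgroupClass.coe_nsmul, ← AddSubgroupClass.coe_nsmul, AddSubgroup.torsionBy.nsmul x,
            ZeroMemClass.coe_zero, ZeroMemClass.coe_zero])⟩ : AddSubgroup.torsionBy W.sha p))
    (fun x y hxy ↦ Subtype.ext (Subtype.ext (congrArg (fun z : AddSubgroup.torsionBy W.sha p ↦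
      (z : W.sha)) hxy)))

omit [W.IsElliptic] in
/-- **Kernel clause on `Ш` ⇒ `p^∞`-divisibility on `Ш[p^∞]`.** For a bi-additive `B` on `Ш(E/K)` whose
left kernel lies in the divisible subgroup, the restriction of `B` to `A = Ш[p^∞]` has left kernel inside
every `p^k A`: an `a ∈ A` orthogonal to `A` is orthogonal to all of `Ш` (`Ш` is torsion; coprime-order
argument), hence divisible in `Ш`, and a `p^k`-th root of `a` may be taken in `A`. (The argument of
`exists_natCard_modN_primaryComponent_sha`.) [folklore] -/
theorem kernel_nsmul_range_of_kernel_divisible (B : W.sha →+ W.sha →+ AddCircle (1 : ℚ))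
    (hkerB : ∀ x, (∀ y, B x y = 0) → x ∈ AddSubgroup.divisibleElements W.sha)
    (a : AddCommGroup.primaryComponent W.sha p)
    (ha : ∀ b : AddCommGroup.primaryComponent W.sha p, B a b = 0) (k : ℕ) :
    a ∈ (nsmulAddMonoidHom (α := AddCommGroup.primaryComponent W.sha p) (p ^ k)).range := by
  obtain ⟨e, he⟩ := primaryComponent_sha_isPrimary W p a
  -- `a` is orthogonal to all of `Ш`
  have hall : ∀ z : W.sha, B a z = 0 := by
    intro z
    have hz := W.isTorsion_sha z
    set n := addOrderOf z with hn
    have hn0 : n ≠ 0 := (hz.addOrderOf_pos).ne'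
    obtain ⟨v, m, hm, hnm⟩ := Nat.exists_eq_pow_mul_and_not_dvd hn0 p hp.out.ne_one
    have hmz : m • z ∈ AddCommGroup.primaryComponent W.sha p := by
      rw [AddCommGroup.mem_primaryComponent]
      refine ⟨v, ?_⟩
      rw [smul_smul, ← hnm, hn, addOrderOf_nsmul_eq_zero]
    have h1 : m • B a z = 0 := by
      rw [← map_nsmul]
      exact ha ⟨m • z, hmz⟩
    have h2 : p ^ e • B a z = 0 := by
      rw [← AddMonoidHom.nsmul_apply, ← map_nsmul]
      have : (p ^ e • a : AddCommGroup.primaryComponent W.sha p) = 0 := he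
      rw [← AddSubgroupClass.coe_nsmul, this, ZeroMemClass.coe_zero, map_zero, AddMonoidHom.zero_apply]
    exact eq_zero_of_coprime_nsmul'
      (Nat.Coprime.pow_left e ((Nat.Prime.coprime_iff_not_dvd hp.out).mpr hm)) h2 h1
  -- hence divisible in `Ш`, hence in `p^k A`
  have hdivz : (a : W.sha) ∈ AddSubgroup.divisibleElements W.sha := hkerB _ hall
  obtain ⟨y, hy⟩ := (AddSubgroup.mem_divisibleElements_iff _ _).mp hdivz (p ^ k) (pow_pos hp.out.pos k)
  have hyA : y ∈ AddCommGroup.primaryComponent W.sha p := by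
    rw [AddCommGroup.mem_primaryComponent]
    refine ⟨k + e, ?_⟩
    rw [pow_add, mul_comm, ← smul_smul, hy, ← AddSubgroupClass.coe_nsmul]
    have : (p ^ e • a : AddCommGroup.primaryComponent W.sha p) = 0 := he
    rw [this, ZeroMemClass.coe_zero]
  exact ⟨⟨y, hyA⟩, Subtype.ext (by rw [nsmulAddMonoidHom_apply, AddSubgroupClass.coe_nsmul]; exact hy)⟩

end PrimaryPart

section Main

variable {K : Type u} [Field K] [NumberField K] {W W' : WeierstrassCurve K} [W.IsElliptic] [W'.IsElliptic]
  (p : ℕ) [hp : Fact p.Prime]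

/-- **The `Ш`-part of Cassels' formula.** Let `f : E(K̄) → E'(K̄)`, `g : E'(K̄) → E(K̄)` be
`Γ_K`-equivariant homomorphisms with local points maps (e.g. an isogeny and its dual) with
`g ∘ f = [p]`, `f ∘ g = [p]`, and let `B`, `B'` be bi-additive alternating pairings on `Ш(E/K)`,
`Ш(E'/K)` with values in `ℚ/ℤ`, whose left kernels lie in the divisible subgroups, adjoint for
`(Ш(f), Ш(g))`. Then `#ker Ш(f) = p^m`, `#ker Ш(g) = p^n` with `corank_{ℤ_p} Ш(E'/K)[p^∞] + m + n` even.
The group theory (abstract isogeny-pair parity for `p`-primary groups with finite `p`-torsion) enters as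
the hypothesis `habs`; the rest is the passage to `Ш[p^∞]` (`kernel_nsmul_range_of_kernel_divisible`,
`finite_torsionBy_primaryComponent_sha`, `(ℚ/ℤ)[p] ≅ ℤ/p`). With the Cassels–Tate pairings this is the
`Ш`-content of Cassels' formula `(-1)^{rk_p} = ∏_v σ_φ` (Dokchitser–Dokchitser, Thm. 30; Milne, *ADT*,
I.6.9, 6.10(a), 6.13(a)). [cite: DokchitserDokchitser2011Crelle, Thm. 30 (arXiv:0906.1815)] -/
theorem exists_natCard_ker_shaMap_even_shaCorank
    (habs : ∀ {A A' : Type u} {Q : Type} [AddCommGroup A] [AddCommGroup A'] [AddCommGroup Q]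
      (p : ℕ) [Fact p.Prime]
      (_hA : ∀ a : A, ∃ n : ℕ, p ^ n • a = 0) (_hA' : ∀ a : A', ∃ n : ℕ, p ^ n • a = 0)
      [Finite A[(p : ℤ)]] [Finite A'[(p : ℤ)]]
      (ι : Q[(p : ℤ)] →+ ZMod p) (_hι : Function.Injective ι)
      (B : A →+ A →+ Q) (B' : A' →+ A' →+ Q) (_hB : ∀ x, B x x = 0) (_hB' : ∀ y, B' y y = 0)
      (_hker : ∀ a, (∀ b, B a b = 0) → ∀ k : ℕ, a ∈ (nsmulAddMonoidHom (α := A) (p ^ k)).range)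
      (_hker' : ∀ a, (∀ b, B' a b = 0) → ∀ k : ℕ, a ∈ (nsmulAddMonoidHom (α := A') (p ^ k)).range)
      (f : A →+ A') (g : A' →+ A) (_hgf : ∀ x, g (f x) = p • x) (_hfg : ∀ y, f (g y) = p • y)
      (_hadj : ∀ x y, B' (f x) y = B x (g y)),
      ∃ m n : ℕ, Nat.card f.ker = p ^ m ∧ Nat.card g.ker = p ^ n ∧ Even (zpCorank A' p + m + n))
    (f : W.geomPoints →+ W'.geomPoints)
    (hf : ∀ (σ : Field.absoluteGaloisGroup K) (P : W.geomPoints), f (σ • P) = σ • f P)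
    (hlocf : HasLocalPointsMaps W W' f)
    (g : W'.geomPoints →+ W.geomPoints)
    (hg : ∀ (σ : Field.absoluteGaloisGroup K) (P : W'.geomPoints), g (σ • P) = σ • g P)
    (hlocg : HasLocalPointsMaps W' W g)
    (hgf : ∀ P, g (f P) = (p : ℤ) • P) (hfg : ∀ Q, f (g Q) = (p : ℤ) • Q)
    (B : W.sha →+ W.sha →+ AddCircle (1 : ℚ)) (B' : W'.sha →+ W'.sha →+ AddCircle (1 : ℚ))
    (hB : ∀ x, B x x = 0) (hB' : ∀ y, B' y y = 0)
    (hBker : ∀ x, (∀ y, B x y = 0) → x ∈ AddSubgroup.divisibleElements W.sha)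
    (hB'ker : ∀ x, (∀ y, B' x y = 0) → x ∈ AddSubgroup.divisibleElements W'.sha)
    (hadj : ∀ x y, B' (shaMap f hf hlocf x) y = B x (shaMap g hg hlocg y)) :
    ∃ m n : ℕ, Nat.card (shaMap f hf hlocf).ker = p ^ m ∧ Nat.card (shaMap g hg hlocg).ker = p ^ n ∧
      Even (W'.shaCorank p + m + n) := by
  haveI := finite_torsionBy_primaryComponent_sha W p
  haveI := finite_torsionBy_primaryComponent_sha W' p
  -- `Ш(g) Ш(f) = p`, `Ш(f) Ш(g) = p`
  have hGF : ∀ x : W.sha, shaMap g hg hlocg (shaMap f hf hlocf x) = p • x := fun x ↦ Subtype.ext (by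
    rw [coe_shaMap_apply, coe_shaMap_apply, AddSubgroupClass.coe_nsmul]
    exact galH1Map_galH1Map_of_comp_eq_nsmul f hf g hg hgf _)
  have hFG : ∀ y : W'.sha, shaMap f hf hlocf (shaMap g hg hlocg y) = p • y := fun y ↦ Subtype.ext (by
    rw [coe_shaMap_apply, coe_shaMap_apply, AddSubgroupClass.coe_nsmul]
    exact galH1Map_galH1Map_of_comp_eq_nsmul g hg f hf hfg _)
  -- restrictions to the `p`-primary parts
  have hFA : ∀ x : AddCommGroup.primaryComponent W.sha p,
      shaMap f hf hlocf x ∈ AddCommGroup.primaryComponent W'.sha p := fun x ↦ by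
    obtain ⟨n, hn⟩ := (AddCommGroup.mem_primaryComponent).mp x.2
    exact (AddCommGroup.mem_primaryComponent).mpr ⟨n, by rw [← map_nsmul, hn, map_zero]⟩
  have hGA : ∀ y : AddCommGroup.primaryComponent W'.sha p,
      shaMap g hg hlocg y ∈ AddCommGroup.primaryComponent W.sha p := fun y ↦ by
    obtain ⟨n, hn⟩ := (AddCommGroup.mem_primaryComponent).mp y.2
    exact (AddCommGroup.mem_primaryComponent).mpr ⟨n, by rw [← map_nsmul, hn, map_zero]⟩
  let FA : AddCommGroup.primaryComponent W.sha p →+ AddCommGroup.primaryComponent W'.sha p :=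
    ((shaMap f hf hlocf).comp (AddCommGroup.primaryComponent W.sha p).subtype).codRestrict _ hFA
  let GA : AddCommGroup.primaryComponent W'.sha p →+ AddCommGroup.primaryComponent W.sha p :=
    ((shaMap g hg hlocg).comp (AddCommGroup.primaryComponent W'.sha p).subtype).codRestrict _ hGA
  have hFA_apply : ∀ x, ((FA x : AddCommGroup.primaryComponent W'.sha p) : W'.sha) = shaMap f hf hlocf x :=
    fun _ ↦ rfl
  have hGA_apply : ∀ y, ((GA y : AddCommGroup.primaryComponent W.sha p) : W.sha) = shaMap g hg hlocg y :=
    fun _ ↦ rfl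
  have hGFA : ∀ x, GA (FA x) = p • x := fun x ↦ Subtype.ext (by
    rw [hGA_apply, hFA_apply, AddSubgroupClass.coe_nsmul, hGF])
  have hFGA : ∀ y, FA (GA y) = p • y := fun y ↦ Subtype.ext (by
    rw [hFA_apply, hGA_apply, AddSubgroupClass.coe_nsmul, hFG])
  -- the pairings restricted
  let BA : AddCommGroup.primaryComponent W.sha p →+ AddCommGroup.primaryComponent W.sha p →+ AddCircle (1 : ℚ) :=
    (AddMonoidHom.compHom' (AddCommGroup.primaryComponent W.sha p).subtype).comp
      (B.comp (AddCommGroup.primaryComponent W.sha p).subtype)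
  let BA' : AddCommGroup.primaryComponent W'.sha p →+ AddCommGroup.primaryComponent W'.sha p →+ AddCircle (1 : ℚ) :=
    (AddMonoidHom.compHom' (AddCommGroup.primaryComponent W'.sha p).subtype).comp
      (B'.comp (AddCommGroup.primaryComponent W'.sha p).subtype)
  have hBA : ∀ a b, BA a b = B a b := fun _ _ ↦ rfl
  have hBA' : ∀ a b, BA' a b = B' a b := fun _ _ ↦ rfl
  obtain ⟨ι, hι⟩ := exists_circleTorsion_toZMod_injective p
  obtain ⟨m, n, hm, hn, hmn⟩ := habs p (primaryComponent_sha_isPrimary W p)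
    (primaryComponent_sha_isPrimary W' p) ι hι BA BA' (fun a ↦ by rw [hBA, hB]) (fun a ↦ by rw [hBA', hB'])
    (fun a ha k ↦ kernel_nsmul_range_of_kernel_divisible W p B hBker a (fun b ↦ (hBA a b) ▸ ha b) k)
    (fun a ha k ↦ kernel_nsmul_range_of_kernel_divisible W' p B' hB'ker a (fun b ↦ (hBA' a b) ▸ ha b) k)
    FA GA hGFA hFGA (fun x y ↦ by rw [hBA', hBA, hFA_apply, hGA_apply, hadj])
  refine ⟨m, n, ?_, ?_, hmn⟩
  · -- `#ker Ш(f) = #ker FA`: the kernel is `p`-torsion, hence inside `Ш[p^∞]`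
    rw [← hm]
    have hle := ker_shaMap_le_torsionBy f hf hlocf g hg hgf
    refine Nat.card_congr (Equiv.ofBijective
      (fun c ↦ ⟨⟨(c : W.sha), (AddCommGroup.mem_primaryComponent).mpr ⟨1, by
          rw [pow_one]; exact AddSubgroup.torsionBy.nsmul_iff.mp (hle c.2)⟩⟩,
        AddMonoidHom.mem_ker.mpr (Subtype.ext
          (show (shaMap f hf hlocf (c : W.sha) : W'.sha) = ((0 : AddCommGroup.primaryComponent W'.sha p) : W'.sha)
            from by rw [AddMonoidHom.mem_ker.mp c.2]; rfl))⟩)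
      ⟨?_, ?_⟩)
    · intro c d h
      exact Subtype.ext (congrArg (fun z : FA.ker ↦ ((z : AddCommGroup.primaryComponent W.sha p) : W.sha)) h)
    · rintro ⟨x, hx⟩
      have hx' : shaMap f hf hlocf (x : W.sha) = 0 := by
        have h0 := congrArg (fun z : AddCommGroup.primaryComponent W'.sha p ↦ (z : W'.sha))
          (AddMonoidHom.mem_ker.mp hx)
        exact h0
      exact ⟨⟨(x : W.sha), AddMonoidHom.mem_ker.mpr hx'⟩, rfl⟩
  · rw [← hn]
    have hle := ker_shaMap_le_torsionBy g hg hlocg f hf hfg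
    refine Nat.card_congr (Equiv.ofBijective
      (fun c ↦ ⟨⟨(c : W'.sha), (AddCommGroup.mem_primaryComponent).mpr ⟨1, by
          rw [pow_one]; exact AddSubgroup.torsionBy.nsmul_iff.mp (hle c.2)⟩⟩,
        AddMonoidHom.mem_ker.mpr (Subtype.ext
          (show (shaMap g hg hlocg (c : W'.sha) : W.sha) = ((0 : AddCommGroup.primaryComponent W.sha p) : W.sha)
            from by rw [AddMonoidHom.mem_ker.mp c.2]; rfl))⟩)
      ⟨?_, ?_⟩)
    · intro c d h
      exact Subtype.ext (congrArg (fun z : GA.ker ↦ ((z : AddCommGroup.primaryComponent W'.sha p) : W'.sha)) h)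
    · rintro ⟨y, hy⟩
      have hy' : shaMap g hg hlocg (y : W'.sha) = 0 := by
        have h0 := congrArg (fun z : AddCommGroup.primaryComponent W.sha p ↦ (z : W.sha))
          (AddMonoidHom.mem_ker.mp hy)
        exact h0
      exact ⟨⟨(y : W'.sha), AddMonoidHom.mem_ker.mpr hy'⟩, rfl⟩

end Main

end Literature.NumberTheory.EllipticCurves

end
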